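import Literature.Probability.Percolation.SlabCircuitGlueLinear
import HarnessLib

/-!
# Newman–Tassion–Wu 2017, Theorem 3.8 / CPAM Theorem 3.10 — FACT 1 (the anti-gluing map) for the
# circuit gluing lemma

Topic: `Literature/Probability/Percolation`.  Fifth file of the circuit gluing layer.  NTW (CPAM p. 15):
"by the same argument as used for Fact 1 in the proof of Theorem 3.9, we can show that there is some
`C₁ < ∞` such that `P[Γ₁ ≈ Γ₂, Γ₁ ↮ Γ₂, |U| ≤ t] ≤ (C₁)^t (1 - x)`".  The anti-gluing map `Φ` closes
the open pairs `{u, v}` with `v` over a column of `Γ`, `u` off the columns of `Γ` and joined to the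
source off them (exactly as the tree's `GlueData.phi1` for paths, `SlabRSWGluingFactOne.lean`, with
`Γ_min^S(A,B)` replaced by the minimal CIRCUIT and radius `0`): `Γ` is unchanged (a sub-configuration
keeping `Γ` open keeps it minimal), the source is unchanged, the entry cells are unchanged, the image is
off `{C̄ ⟷ col(Γ)}`, and every closed pair has an endpoint over an entry cell.

* `CircGlue.closeSet`, `.phi1`; `Γ_phi1`, `src_phi1`, `joinedFar_phi1_iff`, `Uent_phi1`,
  `diff_phi1_subset_Uent`, `phi1_not_mem_evCol`.
* **`CircGlue.fact1`**: `P_p[𝒳 ∩ {|U| ≤ t}] ≤ λ^{(5k+4) t} · P_p[(C̄ ⟷ col(Γ))ᶜ]`.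

## Sources

* C. M. Newman, V. Tassion, W. Wu, *Critical percolation and the minimal spanning tree in slabs*,
  Comm. Pure Appl. Math. 70 (2017) = arXiv:1512.09107: §3.2, proof of Theorem 3.7/3.9 (Fact 1) and of
  Theorem 3.8/3.10, (3.7) [NewmanTassionWu2017].
-/

noncomputable section

namespace Literature.Probability.Percolation

open MeasureTheory LatticeModels SimpleGraph Finset

namespace NTW17

namespace CircGlue

variable {k : ℕ} (D : CircGlue k)

/-- **The pairs closed by `Φ`**: the open pairs `{u, v}` with `v` over a column of `Γ`, `u` off the
columns of `Γ` and joined to the source off them. [cite: NewmanTassionWu2017, §3.2 (proof of Theorem 3.7, Fact 1, the map Φ; CPAM Theorem 3.10, (3.7))] -/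
def closeSet (ω : BondConfig (slab 3 k)) : Set (Sym2 (slab 3 k)) :=
  {e | e ∈ ω ∧ ∃ u v, e = s(u, v) ∧ Near k (D.Γ ω) 0 (planar k v) ∧ ¬Near k (D.Γ ω) 0 (planar k u) ∧
    D.JoinedFar ω u}

/-- **The anti-gluing map `Φ`.** [cite: NewmanTassionWu2017, §3.2 (proof of Theorem 3.7, Fact 1; CPAM Theorem 3.10, (3.7))] -/
def phi1 (ω : BondConfig (slab 3 k)) : BondConfig (slab 3 k) := ω \ D.closeSet ω

variable {D}

/-- `Φ(ω) ⊆ ω`. [cite: NewmanTassionWu2017, §3.2 (proof of Theorem 3.7, Fact 1)] -/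
theorem phi1_subset (ω : BondConfig (slab 3 k)) : D.phi1 ω ⊆ ω := fun _ h => h.1

/-- No pair joining two vertices of `Γ` is closed. [cite: NewmanTassionWu2017, §3.2 (CPAM Theorem 3.10: "except those in Γ₁")] -/
theorem not_mem_closeSet_of_mem_Γ {ω : BondConfig (slab 3 k)} {a b : slab 3 k} (ha : a ∈ D.Γ ω) (hb : b ∈ D.Γ ω) :
    s(a, b) ∉ D.closeSet ω := by
  rintro ⟨-, u, v, heq, -, hu, -⟩
  have hu' : u ∈ D.Γ ω := by
    have : u ∈ s(a, b) := by rw [heq]; exact Sym2.mem_mk_left u v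
    rcases Sym2.mem_iff.1 this with rfl | rfl
    · exact ha
    · exact hb
  exact hu (near_zero_iff.2 ⟨u, hu', rfl⟩)

/-- **`Γ(Φ ω) = Γ(ω)`**: `Γ` stays open, and closing pairs only removes competitors.
[cite: NewmanTassionWu2017, §3.2 (proof of Theorem 3.7, Fact 1; CPAM Theorem 3.10)] -/
theorem Γ_phi1 (ω : BondConfig (slab 3 k)) : D.Γ (D.phi1 ω) = D.Γ ω := by
  by_cases hH : ω ∈ D.evH
  · obtain ⟨⟨h1, h1'⟩, h2⟩ := Γ_spec hH
    have h1'' : IsOpenCircuit k (D.phi1 ω) (slabLift k (annulus D.c D.m D.n)) (D.Γ ω) :=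
      h1.of_edges fun a ha b hb hab => ⟨hab, not_mem_closeSet_of_mem_Γ ha hb⟩
    exact minCircuit_eq_of_min h1'' h1' fun l hl hs => h2 l (hl.mono (phi1_subset ω)) hs
  · have hΓ : D.Γ ω = [] := minCircuit_eq_nil hH
    have hcl : D.closeSet ω = ∅ := by
      ext e
      simp only [closeSet, Set.mem_setOf_eq, Set.mem_empty_iff_false, iff_false]
      rintro ⟨-, u, v, -, hv, -⟩
      obtain ⟨g, hg, -⟩ := near_zero_iff.1 hv
      rw [hΓ] at hg; simp at hg
    simp [phi1, hcl]

/-- Pairs with both endpoints off the columns of `Γ` are untouched by `Φ`. [cite: NewmanTassionWu2017, §3.2 (proof of Theorem 3.7, Fact 1)] -/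
theorem mem_phi1_iff_of_far {ω : BondConfig (slab 3 k)} {e : Sym2 (slab 3 k)}
    (he : e ∈ (slabLift k D.W ∩ {x | ¬Near k (D.Γ ω) 0 (planar k x)}).sym2) : e ∈ ω ↔ e ∈ D.phi1 ω := by
  refine ⟨fun h => ⟨h, ?_⟩, fun h => h.1⟩
  rintro ⟨-, u, v, rfl, hv, -, -⟩
  exact (Set.mk_mem_sym2_iff.1 he).2.2 hv

/-- Pairs not touching the columns over `B_n(c)` are untouched by `Φ`; so the source is unchanged.
[cite: NewmanTassionWu2017, §3.2 (CPAM Theorem 3.10: Γ₂ unchanged)] -/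
theorem src_phi1 (ω : BondConfig (slab 3 k)) : D.src (D.phi1 ω) = D.src ω := by
  refine (D.hsrc_loc ω (D.phi1 ω) fun e _ he => ⟨fun h => ⟨h, ?_⟩, fun h => h.1⟩).symm
  rintro ⟨-, u, v, rfl, hv, -, -⟩
  exact he ⟨v, Sym2.mem_mk_right u v, (mem_of_near_zero hv).2.1⟩

/-- `JoinedFar` is unchanged by `Φ`. [cite: NewmanTassionWu2017, §3.2 (proof of Theorem 3.7, Fact 1)] -/
theorem joinedFar_phi1_iff {ω : BondConfig (slab 3 k)} (u : slab 3 k) : D.JoinedFar (D.phi1 ω) u ↔ D.JoinedFar ω u := by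
  simp only [JoinedFar, Γ_phi1, src_phi1]
  refine exists_congr fun c₀ => and_congr_right fun _ => ?_
  exact (openConnIn_congr (fun e he => mem_phi1_iff_of_far he) c₀ u).symm

/-- **`U(Φ ω) = U(ω)`.** [cite: NewmanTassionWu2017, §3.2 (proof of Theorem 3.7, Fact 1: bounded pre-image)] -/
theorem Uent_phi1 (ω : BondConfig (slab 3 k)) : D.Uent (D.phi1 ω) = D.Uent ω := by
  ext y
  simp only [Uent, Set.mem_setOf_eq, Γ_phi1, joinedFar_phi1_iff]

/-- `U(ω)` is determined by the pairs over the world. [cite: NewmanTassionWu2017, §3.2 (proof of Theorem 3.7, Fact 1)] -/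
theorem Uent_congr {ω ω' : BondConfig (slab 3 k)} (h : ∀ e ∈ (slabLift k D.W).sym2, (e ∈ ω ↔ e ∈ ω')) :
    D.Uent ω = D.Uent ω' := by
  obtain ⟨hΓ, hsrc⟩ := Γ_src_congr_W h
  ext y
  simp only [Uent, JoinedFar, Set.mem_setOf_eq, hΓ, hsrc]
  refine and_congr_right fun _ => exists_congr fun u => exists_congr fun v => and_congr_right fun _ =>
    and_congr_right fun _ => and_congr_right fun _ => exists_congr fun c₀ => and_congr_right fun _ => ?_
  refine openConnIn_congr (fun e he => h e ?_) c₀ u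
  induction e using Sym2.ind with
  | h _ _ => rw [Set.mk_mem_sym2_iff] at he ⊢; exact ⟨he.1.1, he.2.1⟩

/-- The closed pairs have an endpoint over an entry cell of `Φ ω` (lattice configurations).
[cite: NewmanTassionWu2017, §3.2 (proof of Theorem 3.7, Fact 1)] -/
theorem diff_phi1_subset_Uent {ω : BondConfig (slab 3 k)} (hω : ω ⊆ (slabGraph 3 k).edgeSet) :
    ω \ D.phi1 ω ⊆ {e | ∃ v ∈ e, planar k v ∈ D.Uent (D.phi1 ω)} := by
  rintro e ⟨he, hne⟩
  have he' : e ∈ D.closeSet ω := by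
    by_contra h
    exact hne ⟨he, h⟩
  obtain ⟨heω, u, v, rfl, hv, hu, hj⟩ := he'
  refine ⟨v, Sym2.mem_mk_right u v, ?_⟩
  rw [Uent_phi1]
  exact ⟨hv, u, v, rfl, (SimpleGraph.mem_edgeSet _).1 (hω heω), hu, hj⟩

/-- **`Φ` disconnects the source from the columns of `Γ`**: follow an open path of `Φ ω` inside `W̄` from
the source to its first vertex over a column of `Γ`; the pair into that vertex lies in `closeSet ω`.
[cite: NewmanTassionWu2017, §3.2 (proof of Theorem 3.7, Fact 1: "Φ(ω) cannot contain any open path from C to 𝒩(Γ̄, r)")] -/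
theorem phi1_not_mem_evCol {ω : BondConfig (slab 3 k)} : D.phi1 ω ∉ D.evCol := by
  rintro ⟨c₀, hc₀, q, hj, hnear⟩
  rw [Γ_phi1] at hnear
  rw [src_phi1] at hc₀
  obtain ⟨L, hL⟩ := exists_isOSAP_of_openConnIn hj
  have hqL : q ∈ L := by
    have := hL.last_mem hL.ne_nil
    rw [Set.mem_singleton_iff] at this
    rw [← this]; exact List.getLast_mem _
  obtain ⟨l, x₁, l₂, hLeq, hx₁, hl⟩ :=
    exists_first_split (p := fun x => Near k (D.Γ ω) 0 (planar k x)) L ⟨q, hqL, hnear⟩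
  have hc₀far : ¬Near k (D.Γ ω) 0 (planar k c₀) := not_near_src hc₀
  have hhead : L.head hL.ne_nil = c₀ := by
    have := hL.head_mem hL.ne_nil
    rwa [Set.mem_singleton_iff] at this
  have hlne : l ≠ [] := by
    rintro rfl
    have : x₁ = c₀ := by rw [← hhead]; simp [hLeq]
    subst this
    exact hc₀far hx₁
  set u := l.getLast hlne with hu
  have hLeq' : L = l.dropLast ++ u :: x₁ :: l₂ := by
    rw [hLeq]; conv_lhs => rw [← List.dropLast_append_getLast hlne]
    simp [hu]
  have hedge : s(u, x₁) ∈ D.phi1 ω := ((List.isChain_iff_forall_rel_of_append_cons_cons.1 hL.chain) hLeq').1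
  have hufar : ¬Near k (D.Γ ω) 0 (planar k u) := hl u (List.getLast_mem hlne)
  -- `u` is joined to `c₀` off the columns of `Γ`, by the prefix `l` (open in `Φ ω ⊆ ω`)
  have hjf : D.JoinedFar ω u := by
    refine ⟨c₀, hc₀, ?_⟩
    obtain ⟨a, l', hl'⟩ := List.exists_cons_of_ne_nil hlne
    have hch : (a :: l').IsChain (fun x z => s(x, z) ∈ ω ∧ x ≠ z) := by
      have := hL.chain; rw [hLeq, hl'] at this
      exact ((List.isChain_append.1 this).1).imp fun x z hxz => ⟨phi1_subset ω hxz.1, hxz.2⟩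
    have hsub : ∀ x ∈ a :: l', x ∈ slabLift k D.W ∩ {x | ¬Near k (D.Γ ω) 0 (planar k x)} := by
      intro x hx
      exact ⟨hL.subset x (by rw [hLeq, hl']; exact List.mem_append_left _ hx), hl x (hl' ▸ hx)⟩
    have hconn := openConnIn_of_isChain a l' hch hsub
    have ha : a = c₀ := by rw [← hhead]; simp [hLeq, hl']
    have hlast : (a :: l').getLast (List.cons_ne_nil _ _) = u := by simp only [hu, hl']
    rw [hlast] at hconn
    subst ha
    exact hconn
  exact hedge.2 ⟨phi1_subset ω hedge, u, x₁, rfl, hx₁, hufar, hjf⟩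

/-- **FACT 1 for the circuit gluing lemma**: for every `CircGlue` datum, `0 < p < 1` and `t`,
`P_p[𝒳 ∩ {|U| ≤ t}] ≤ (2/min{p,1-p})^{(5k+4) t} · P_p[(C̄ ⟷^{W̄} col(Γ))ᶜ]`.
Proof: `Φ` maps `𝒳 ∩ {|U| ≤ t}` into `evColᶜ`; the preimages of `ω′` agree with `ω′` off the at most
`(5k+4) t` lattice pairs over the entry cells of `ω′` (`Uent_phi1`, `diff_phi1_subset_Uent`); Lemma 3.5.
[cite: NewmanTassionWu2017, §3.2 (CPAM Theorem 3.10, (3.7): P[Γ₁ ≈ Γ₂, Γ₁ ↮ Γ₂, |U| ≤ t] ≤ (C₁)^t (1-x))] -/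
theorem fact1 (D : CircGlue k) (p : unitInterval) (hp0 : 0 < (p : ℝ)) (hp1 : (p : ℝ) < 1) (t : ℕ) :
    (bondPercolation (slabGraph 3 k) p).real (D.evX ∩ {ω | (D.Uent ω).ncard ≤ t}) ≤
      (2 / min (p : ℝ) (1 - p)) ^ ((5 * k + 4) * t) * (bondPercolation (slabGraph 3 k) p).real (D.evCol)ᶜ := by
  classical
  set P := bondPercolation (slabGraph 3 k) p with hP
  have hWfin : (slabLift k D.W).Finite := slabLift_finite k D.hWfin
  set K' : Finset (Sym2 (slab 3 k)) := (finite_sym2 hWfin).toFinset with hK'def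
  have hK'coe : (↑K' : Set (Sym2 (slab 3 k))) = (slabLift k D.W).sym2 := Set.Finite.coe_toFinset _
  set Kfin : Finset (Sym2 (slab 3 k)) := K'.filter (· ∈ (slabGraph 3 k).edgeSet) with hKfin
  have hK : ∀ e, e ∈ Kfin ↔ e ∈ K' ∧ e ∈ (slabGraph 3 k).edgeSet := fun e => Finset.mem_filter
  have hKE : ∀ e ∈ Kfin, e ∈ (slabGraph 3 k).edgeSet := fun e he => ((hK e).1 he).2
  have hagree : ∀ ω ω' : BondConfig (slab 3 k), ω ∩ ↑K' = ω' ∩ ↑K' →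
      ∀ e ∈ (slabLift k D.W).sym2, (e ∈ ω ↔ e ∈ ω') := by
    intro ω ω' heq e he
    rw [← hK'coe] at he
    have := Set.ext_iff.1 heq e
    simp only [Set.mem_inter_iff, he, and_true] at this
    exact this
  obtain ⟨hdX, -, hdC⟩ := determinedBy_events (D := D)
  have hA : DeterminedBy (D.evX ∩ {ω | (D.Uent ω).ncard ≤ t}) ↑K' := by
    rw [determinedBy_iff]
    intro ω ω' heq
    simp only [Set.mem_inter_iff, Set.mem_setOf_eq]
    rw [(determinedBy_iff _ _).1 hdX ω ω' (by rw [hK'coe] at heq; exact heq), Uent_congr (hagree ω ω' heq)]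
  have hB : DeterminedBy (D.evCol)ᶜ ↑K' := by
    rw [hK'coe]; exact hdC.compl
  let Φ : Finset (Sym2 (slab 3 k)) → Finset (Finset (Sym2 (slab 3 k))) := fun S => {S.filter (· ∉ D.closeSet ↑S)}
  have hΦcoe : ∀ S : Finset (Sym2 (slab 3 k)), (↑(S.filter (· ∉ D.closeSet ↑S)) : Set (Sym2 (slab 3 k))) = D.phi1 ↑S := by
    intro S
    ext e
    simp [CircGlue.phi1]
  have hmain := lemma7_bond (slabGraph 3 k) p hp0 hp1 K' Kfin hK hA hB ((5 * k + 4) * t) one_pos Φ ?_ ?_ ?_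
  · simpa using hmain
  · intro S hS _ S' hS'
    have hS'eq : S' = S.filter (· ∉ D.closeSet ↑S) := Finset.mem_singleton.1 hS'
    subst hS'eq
    refine ⟨(Finset.filter_subset _ S).trans hS, ?_⟩
    rw [hΦcoe]
    exact phi1_not_mem_evCol
  · intro S _ _
    simp [Φ]
  · intro S' _ _
    by_cases hsmall : (D.Uent (↑S' : BondConfig (slab 3 k))).ncard ≤ t
    · refine ⟨Kfin.filter fun e => ∃ u ∈ e, planar k u ∈ (Uent_finite (D := D) (↑S' : BondConfig (slab 3 k))).toFinset, ?_, ?_⟩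
      · refine (card_filter_colEdges_le k Kfin hKE _).trans ?_
        rw [← Set.ncard_eq_toFinset_card _ (Uent_finite (↑S' : BondConfig (slab 3 k)))]
        exact Nat.mul_le_mul_left _ hsmall
      · intro S hS _ hmem e heT
        have hS'eq : S' = S.filter (· ∉ D.closeSet ↑S) := Finset.mem_singleton.1 hmem
        constructor
        · intro heS
          by_contra heS'
          apply heT
          have hdiff : e ∈ (↑S : Set (Sym2 (slab 3 k))) \ D.phi1 ↑S := by
            refine ⟨heS, ?_⟩
            rw [← hΦcoe, ← hS'eq]
            exact heS'
          obtain ⟨v, hve, hv⟩ := diff_phi1_subset_Uent (fun e he => hKE e (hS he)) hdiff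
          rw [← hΦcoe, ← hS'eq] at hv
          exact Finset.mem_filter.2 ⟨hS heS, v, hve, (Set.Finite.mem_toFinset _).2 hv⟩
        · intro heS'
          rw [hS'eq] at heS'
          exact (Finset.mem_filter.1 heS').1
    · refine ⟨∅, by simp, ?_⟩
      intro S _ hSA hmem
      exfalso
      apply hsmall
      have hS'eq : S' = S.filter (· ∉ D.closeSet ↑S) := Finset.mem_singleton.1 hmem
      rw [hS'eq, hΦcoe, Uent_phi1]
      exact hSA.2

end CircGlue

end NTW17

end Literature.Probability.Percolation

end
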